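import Literature.NumberTheory.LFunctions.Zhang2022.KnifeEdgeLenSiegelModuli
import Literature.NumberTheory.LFunctions.Zhang2022.KnifeEdgeSlotCalculus

/-!
# Zhang (2022), rung F-S3 (Landau–Siegel programme, §D edge len = E*-len⁺): card `siegel-model-family-index`
# (ls-knife-len-idea-2) — the SIEGEL FAMILY (every modulus of the window, density `Λ_Siegel/log`), its
# discrete mean, and Zhang's prime family `Ψ` as its prime fibre

Y. Zhang, *Discrete mean estimates and the Landau–Siegel zero*, arXiv:2211.02515v1 [Zhang2022LandauSiegel] —
an unrefereed manuscript under adjudication; T. Tao, J. Teräväinen [TaoTeravainen2021] (the Siegel model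
`Λ_Siegel = (χ ∗ log)·ν_R`). **WHAT THIS IS NOT: not a claim about Theorems 1–2 of arXiv:2211.02515, about
Landau–Siegel zeros, or about Parity. The programme SEARCHES and TYPES; no claim about Landau–Siegel zeros,
Theorems 1–2 of arXiv:2211.02515 or a repaired Margin232 until a kernel theorem says so. Nothing here asserts an
estimate: the file is `def`s (same formulas as the skeleton's, at an arbitrary modulus of the window) and finite
bookkeeping theorems; the card's first lemma `KnifeEdge.SiegelModuliTransfer c` (K1, p466795, OPEN) is not used
here — the transfer calculus proved FROM it is the companion `KnifeEdgeLenSiegelTransfer`.**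

WHY (critic ls-knife-crit-1 2026-08-26T21:28Z on the card, new-combination KEPT OPEN; referee ls-ref-1 21:21Z):
the card's usable first rung is (a) K1 with `c > 0` and (b) the implication «K1 ∧ ⟨slot of the
`(χ∗log)ν_R`-weighted COMPOSITE family⟩ ⇒ ⟨the same slot of Zhang's PRIME family⟩» with the sup/avg bookkeeping
explicit. This file builds the objects that implication is about:

* Part 1. The **Siegel family index** `SChr D` = (modulus `m` of the integer window `moduliWindow D`, prime or
  not; primitive `ψ (mod m)`), finite (`SChr.finite`, a theorem), and the embedding `toS : Chr D → SChr D` of `Ψ`.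
* Part 2–3. On it, the SAME formulas as the skeleton's objects on `Ψ`: `pcS`, `profPolyS`, `blockPolyS` (cf.
  `Skeleton.pc`, `KnifeEdge.profPoly`, `blockPoly`), `X1S…X4S` and `PsiOneS` = Zhang's (3.4)–(3.6) VERBATIM at an
  arbitrary modulus (the card: «`Ψ₁(m)` for composite `m` is (3.4)–(3.6) verbatim»), `zeroSetS`, `cstarS`; on the
  prime fibre each IS the skeleton's (`pcS_toS`, …, `cstarS_toS`, all `rfl`).
* Part 4. The **Siegel density** `siegelDensity χ ψc m = Λ_Siegel(m)/log m` (`≥ 0` for quadratic `χ`; `= 1` on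
  primes `p ≥ R`, `vonMangoldtSiegel_prime`), the normaliser `frakPS = Σ_{m∈W} w(m)·m` (analogue of `𝔓`), the
  PER-MODULUS slices `modPolar`/`modMean` (the `Ψ₁(m) × zeros` block of a polar form / mean at one modulus — the
  referee's statistic `G(m)`), and the Siegel family's polar form / mean `discPolarS = Σ_m w(m)·modPolar m`,
  `discMeanS`.
* Part 5 (PROVED). Zhang's prime-family polar form / mean (`KnifeEdge.discPolar`, `discMean` over `Skeleton.idx`)
  of tables restricted along `toS` IS the unweighted sum of the same slices over the PRIME moduli:
  `sum_idx_eq_sum_primeWindow`, `discPolar_eq_sum_modPolar`, `discMean_eq_sum_modMean`.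

Pinned scales (`P = exp 𝓛⁹`, `Skeleton.*`), as in `KnifeEdgeLenSiegelModuli`. Typer: ls-knife-typer-1 (cell
landau-siegel §D).

## References
* Y. Zhang, arXiv:2211.02515v1 (2022), §2 p.4 (the family `Ψ`, `p ∼ P`), (2.9), (2.14)–(2.17), §3 (3.4)–(3.6),
  §8 (8.3). [cite: Zhang2022LandauSiegel, §2, §3, §8]
* T. Tao, J. Teräväinen, arXiv:2109.06291, §5 (the Siegel model). [cite: TaoTeravainen2021, §5]
-/

noncomputable section

open Finset Real Complex ComplexConjugate

namespace Literature.NumberTheory.LFunctions.Zhang2022.KnifeEdge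

open Skeleton
open Literature.Barriers.Parity.TaoTeravainen (IsSmoothCutoff vonMangoldtSiegel vonMangoldtSiegel_prime)

/-! ### Part 1 — the Siegel family index: every modulus of the window, primitive characters -/

/-- **A member of the SIEGEL FAMILY**: a modulus `m` of the integer window `(P, P(1+𝓛⁻⁶⁸))` (`moduliWindow`, prime
or not) with a primitive character `ψ (mod m)` — the family index on which the card's linearised weight
`Λ_Siegel(m)` lives; Zhang's `Ψ` (`Skeleton.Chr`) is its prime fibre (`toS`). [cite: Zhang2022LandauSiegel, §2 p.4] -/
structure SChr (D : ℕ) where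
  /-- the modulus `m`, `P < m < P(1+𝓛⁻⁶⁸)` -/
  m : ℕ
  /-- membership in the integer window -/
  mem : m ∈ moduliWindow D
  /-- the character `ψ (mod m)` -/
  ψ : DirichletCharacter ℂ m
  /-- `ψ` is primitive -/
  prim : ψ.IsPrimitive

namespace SChr

variable {D : ℕ}

/-- A modulus of the window is `≥ 1` (it exceeds `⌊P⌋`). [cite: Zhang2022LandauSiegel, §2 p.4] -/
theorem one_le (y : SChr D) : 1 ≤ y.m := by
  have h := (Finset.mem_Ioo.mp y.mem).1
  omega

/-- A modulus of the window is non-zero (a `NeZero` witness kept as a theorem; use `haveI`). [cite: Zhang2022LandauSiegel, §2 p.4] -/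
theorem neZero (y : SChr D) : NeZero y.m := ⟨by have := y.one_le; omega⟩

/-- The Siegel family embeds in `Σ_{m ∈ W} (characters mod m)`. [folklore] -/
def toSigma (y : SChr D) : (q : moduliWindow D) × DirichletCharacter ℂ (q : ℕ) := ⟨⟨y.m, y.mem⟩, y.ψ⟩

/-- `toSigma` is injective. [folklore] -/
private theorem toSigma_injective : Function.Injective (toSigma (D := D)) := by
  rintro ⟨m, hm, ψ, hψ⟩ ⟨m', hm', ψ', hψ'⟩ h
  simp only [toSigma, Sigma.mk.injEq, Subtype.mk.injEq] at h
  obtain ⟨rfl, h2⟩ := h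
  simp only [heq_eq_eq] at h2
  subst h2; rfl

/-- **The Siegel family is finite** (finitely many moduli in the window, finitely many characters each); a theorem,
not an instance — use `haveI := SChr.finite`. [cite: Zhang2022LandauSiegel, §2 p.4] -/
theorem finite : Finite (SChr D) := by
  haveI : ∀ q : moduliWindow D, NeZero (q : ℕ) := fun q =>
    ⟨by have h := (Finset.mem_Ioo.mp q.2).1; omega⟩
  exact Finite.of_injective _ toSigma_injective

/-- A member of the Siegel family with PRIME modulus is a member of Zhang's `Ψ`. [cite: Zhang2022LandauSiegel, §2 p.4] -/
def toChr (y : SChr D) (hp : y.m.Prime) : Chr D := ⟨y.m, Finset.mem_filter.mpr ⟨y.mem, hp⟩, y.ψ, y.prim⟩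

end SChr

variable {D : ℕ}

/-- **Zhang's `Ψ` inside the Siegel family**: `(p, ψ) ↦ (p, ψ)` (a prime of the window is a modulus of the window,
`primeWindow_eq_filter`). [cite: Zhang2022LandauSiegel, §2 p.4] -/
def toS (x : Chr D) : SChr D := ⟨x.p, (Finset.mem_filter.mp x.mem).1, x.ψ, x.prim⟩

/-- The modulus is unchanged by `toS`. [cite: Zhang2022LandauSiegel, §2 p.4] -/
@[simp] theorem toS_m (x : Chr D) : (toS x).m = x.p := rfl

/-- `toS` after `toChr` is the identity. [cite: Zhang2022LandauSiegel, §2 p.4] -/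
@[simp] theorem toS_toChr (y : SChr D) (hp : y.m.Prime) : toS (y.toChr hp) = y := by
  cases y; rfl

/-- `toChr` after `toS` is the identity. [cite: Zhang2022LandauSiegel, §2 p.4] -/
@[simp] theorem toChr_toS (x : Chr D) (hp : (toS x).m.Prime) : (toS x).toChr hp = x := by
  cases x; rfl

/-- `toS` is injective. [cite: Zhang2022LandauSiegel, §2 p.4] -/
theorem toS_injective : Function.Injective (toS (D := D)) := by
  rintro ⟨p, hp, ψ, hψ⟩ ⟨p', hp', ψ', hψ'⟩ h
  simp only [toS, SChr.mk.injEq] at h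
  obtain ⟨rfl, h2⟩ := h
  simp only [heq_eq_eq] at h2
  subst h2; rfl

/-! ### Part 2 — the skeleton's per-character objects on the Siegel family (same formulas) -/

section Objects

variable (χ : DirichletCharacter ℂ D) (y : SChr D)

/-- `ψχ(n)` for a member of the Siegel family (the formula of `Skeleton.pc`). [cite: Zhang2022LandauSiegel, §2 (2.23)] -/
def pcS (n : ℕ) : ℂ := y.ψ (n : ZMod y.m) * χ (n : ZMod D)

/-- The profile polynomial `Σ_{1≤n<N} χψ(n)·g(log n/log P)·n^{−s}` for a member of the Siegel family (the formula of
`KnifeEdge.profPoly`). [cite: Zhang2022LandauSiegel, §2 (2.23)–(2.25), §7 (7.2)] -/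
def profPolyS (g : ℝ → ℂ) (N : ℕ) (s : ℂ) : ℂ :=
  ∑ n ∈ Finset.Ico 1 N, pcS χ y n * g (Real.log n / Real.log (bigP D)) * (n : ℂ) ^ (-s)

/-- The block `Σ_{M≤n<N} χψ(n)·g(log n/log P)·n^{−s}` for a member of the Siegel family (the formula of
`KnifeEdge.blockPoly`). [cite: Zhang2022LandauSiegel, §2 (2.23), (2.30)] -/
def blockPolyS (M N : ℕ) (g : ℝ → ℂ) (s : ℂ) : ℂ :=
  ∑ n ∈ Finset.Ico M N, pcS χ y n * g (Real.log n / Real.log (bigP D)) * (n : ℂ) ^ (-s)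

/-- `X₁(x,ψ) = Σ_{n≤x} ν₂₀(n)ψ(n)n^{−s₀}` for a member of the Siegel family (formula of `Skeleton.X1`).
[cite: Zhang2022LandauSiegel, §3 p.7] -/
def X1S (t : ℝ) : ℂ := ∑ n ∈ Finset.Icc 1 ⌊t⌋₊, nu20 χ n * y.ψ (n : ZMod y.m) * (n : ℂ) ^ (-s0 D)

/-- `X₂(x,ψ) = Σ_{n≤x} υ₂₀(n)ψ(n)n^{−s₀}` for a member of the Siegel family (formula of `Skeleton.X2`).
[cite: Zhang2022LandauSiegel, §3 p.7] -/
def X2S (t : ℝ) : ℂ := ∑ n ∈ Finset.Icc 1 ⌊t⌋₊, ups20 χ n * y.ψ (n : ZMod y.m) * (n : ℂ) ^ (-s0 D)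

/-- `X₃(x,ψ) = Σ_{D⁴<n≤x} ν(n)ψ(n)n^{−s₀}` for a member of the Siegel family (formula of `Skeleton.X3`).
[cite: Zhang2022LandauSiegel, §3 p.7] -/
def X3S (t : ℝ) : ℂ := ∑ n ∈ Finset.Ioc (D ^ 4) ⌊t⌋₊, nu χ n * y.ψ (n : ZMod y.m) * (n : ℂ) ^ (-s0 D)

/-- `X₄(x,ψ) = Σ_{D⁴<n≤x} ς(n)ψ(n)n^{−s₀}` for a member of the Siegel family (formula of `Skeleton.X4`).
[cite: Zhang2022LandauSiegel, §3 p.7] -/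
def X4S (t : ℝ) : ℂ := ∑ n ∈ Finset.Ioc (D ^ 4) ⌊t⌋₊, sig χ n * y.ψ (n : ZMod y.m) * (n : ℂ) ^ (-s0 D)

/-- **`Ψ₁` of the Siegel family: Zhang's (3.4), (3.5), (3.6) VERBATIM at an arbitrary modulus of the window** (the
card: «`Ψ₁(m)` for composite `m` is (3.4)–(3.6) verbatim»; on the prime fibre it is `Skeleton.PsiOne`, `toS_mem_psiOneS`).
[cite: Zhang2022LandauSiegel, §3 (3.4)–(3.6)] -/
def PsiOneS : Set (SChr D) :=
  {y | (‖X1S χ y ((D : ℝ) ^ 80)‖ + ‖X2S χ y ((D : ℝ) ^ 80)‖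
        + ∫ t in (1 : ℝ)..(D : ℝ) ^ 80, (‖X1S χ y t‖ + ‖X2S χ y t‖) / t < ell D ^ 1171) ∧
      (‖X3S χ y (bigP D ^ 2)‖ + ∫ t in (D : ℝ) ^ 4..bigP D ^ 2, ‖X3S χ y t‖ / t < (ell D ^ 585)⁻¹) ∧
      (‖X4S χ y ((D : ℝ) ^ 8)‖ + ∫ t in (D : ℝ) ^ 4..(D : ℝ) ^ 8, ‖X4S χ y t‖ / t < (ell D ^ 633)⁻¹)}

end Objects

/-- **`𝔷(ψ)`** (2.14) for a member of the Siegel family: the zeros of `L(s,ψ)` with `|σ − 1/2| < 1/2`,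
`|t − 2πt₀| < 𝓛₁` (formula of `Skeleton.zeroSet`). [cite: Zhang2022LandauSiegel, §2 (2.14)] -/
def zeroSetS (D : ℕ) (y : SChr D) : Set ℂ :=
  haveI := y.neZero;
  {ρ | |ρ.re - 1 / 2| < 1 / 2 ∧ |ρ.im - 2 * π * t0 D| < ell1 D ∧ y.ψ.LFunction ρ = 0}

/-- **`𝔠*(ρ,ψ) = −iM(ρ+β₁,ψ)M(ρ+β₂,ψ)M(ρ+β₃,ψ)/M′(ρ,ψ)`** for a member of the Siegel family (formula of
`Skeleton.cstar`, `M = Skeleton.Mfun`). [cite: Zhang2022LandauSiegel, §2 p.5] -/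
def cstarS (c' : ℝ) (D : ℕ) (y : SChr D) (ρ : ℂ) : ℂ :=
  haveI := y.neZero;
  -I * Mfun y.ψ (ρ + beta1 c' D) * Mfun y.ψ (ρ + beta2 c' D) * Mfun y.ψ (ρ + beta3 c' D) / deriv (Mfun y.ψ) ρ

/-! ### Part 3 — on Zhang's prime family every Siegel-family object IS the skeleton's (definitional) -/

section Agreement

variable (χ : DirichletCharacter ℂ D) (x : Chr D)

/-- `pcS ∘ toS = Skeleton.pc`. [cite: Zhang2022LandauSiegel, §2 (2.23)] -/
theorem pcS_toS (n : ℕ) : pcS χ (toS x) n = pc χ x n := rfl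

/-- `profPolyS ∘ toS = KnifeEdge.profPoly`. [cite: Zhang2022LandauSiegel, §2 (2.23)] -/
theorem profPolyS_toS (g : ℝ → ℂ) (N : ℕ) (s : ℂ) : profPolyS χ (toS x) g N s = profPoly χ x g N s := rfl

/-- `blockPolyS ∘ toS = KnifeEdge.blockPoly`. [cite: Zhang2022LandauSiegel, §2 (2.30)] -/
theorem blockPolyS_toS (M N : ℕ) (g : ℝ → ℂ) (s : ℂ) : blockPolyS χ (toS x) M N g s = blockPoly χ x M N g s := rfl

/-- On the prime fibre `Ψ₁` of the Siegel family is Zhang's `Ψ₁`. [cite: Zhang2022LandauSiegel, §3 (3.4)–(3.6)] -/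
theorem toS_mem_psiOneS : toS x ∈ PsiOneS χ ↔ x ∈ PsiOne χ := Iff.rfl

end Agreement

/-- `zeroSetS ∘ toS = Skeleton.zeroSet`. [cite: Zhang2022LandauSiegel, §2 (2.14)] -/
theorem zeroSetS_toS (x : Chr D) : zeroSetS D (toS x) = zeroSet D x := rfl

/-- `cstarS ∘ toS = Skeleton.cstar`. [cite: Zhang2022LandauSiegel, §2 p.5] -/
theorem cstarS_toS (c' : ℝ) (x : Chr D) (ρ : ℂ) : cstarS c' D (toS x) ρ = cstar c' D x ρ := rfl

/-! ### Part 4 — the Siegel density on the modulus, the per-modulus slices and the Siegel family's discrete mean -/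

section Density

variable (χ : DirichletCharacter ℂ D) (ψc : ℝ → ℝ)

/-- **The Siegel density of a modulus**: `w(m) = Λ_Siegel(m)/log m` (`siegelModulusWeight`/`log`), the weight with
which the modulus `m` enters the Siegel family — `≥ 0` for quadratic `χ`, `= 1` on the primes `p ≥ R` of the window,
so the prime family sits inside with density one. [cite: TaoTeravainen2021, §5; Zhang2022LandauSiegel, §2 p.4] -/
def siegelDensity (m : ℕ) : ℝ := siegelModulusWeight χ ψc m / Real.log m

/-- `w(m) ≥ 0` for quadratic `χ`. [cite: TaoTeravainen2021, §5] -/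
theorem siegelDensity_nonneg (hχ : χ.IsQuadratic) (m : ℕ) : 0 ≤ siegelDensity χ ψc m :=
  div_nonneg (siegelModulusWeight_nonneg hχ ψc m) (Real.log_natCast_nonneg m)

/-- `w(p) = 1` on primes `p ≥ R > 1` (`Λ_Siegel(p) = log p` there, `vonMangoldtSiegel_prime`).
[cite: TaoTeravainen2021, §5 (proof of Lemma 5.1)] -/
theorem siegelDensity_prime {ψc : ℝ → ℝ} (hψ : IsSmoothCutoff ψc) (hR : 1 < siegelLevel D) {p : ℕ}
    (hp : p.Prime) (hpR : siegelLevel D ≤ p) : siegelDensity χ ψc p = 1 := by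
  unfold siegelDensity siegelModulusWeight
  rw [vonMangoldtSiegel_prime χ hψ hR hp hpR]
  have hp1 : (1 : ℝ) < p := lt_of_lt_of_le hR hpR
  exact div_self (Real.log_pos hp1).ne'

/-- **The Siegel family's normaliser** `𝔓_S = Σ_{m ∈ W} w(m)·m` (the analogue of `𝔓 = Σ_{p∼P} p` (2.9)).
[cite: Zhang2022LandauSiegel, §2 (2.9)] -/
def frakPS (D : ℕ) (χ : DirichletCharacter ℂ D) (ψc : ℝ → ℝ) : ℝ :=
  ∑ m ∈ moduliWindow D, siegelDensity χ ψc m * m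

/-- `𝔓_S ≥ 0` for quadratic `χ`. [cite: Zhang2022LandauSiegel, §2 (2.9)] -/
theorem frakPS_nonneg (hχ : χ.IsQuadratic) : 0 ≤ frakPS D χ ψc :=
  Finset.sum_nonneg fun m _ => mul_nonneg (siegelDensity_nonneg χ ψc hχ m) (Nat.cast_nonneg m)

end Density

section Slices

variable (c' : ℝ) (χ : DirichletCharacter ℂ D)

/-- The `Ψ₁`-members of the Siegel family at ONE modulus `k` (as a `Finset`; the family is finite).
[cite: Zhang2022LandauSiegel, §3 p.7] -/
def famAt (k : ℕ) : Finset (SChr D) := finsetOf {y | y.m = k ∧ y ∈ PsiOneS χ}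

/-- Membership in `famAt`. [cite: Zhang2022LandauSiegel, §3 p.7] -/
theorem mem_famAt {k : ℕ} {y : SChr D} : y ∈ famAt χ k ↔ y.m = k ∧ y ∈ PsiOneS χ := by
  haveI := SChr.finite (D := D)
  exact mem_finsetOf (Set.toFinite _)

/-- **The per-modulus slice of a polar form**: `Σ_{ψ ∈ Ψ₁(k)} Σ_{ρ ∈ 𝔷(ψ)} Re 𝔠*(ρ,ψ)·Re ω(ρ)·U(ψ,ρ)·V̄(ψ,ρ)` — the
block of the discrete polar form contributed by the modulus `k` (the referee's per-modulus statistic `G(m)`).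
[cite: Zhang2022LandauSiegel, §2 (2.16)–(2.17), §8 (8.3)] -/
def modPolar (U V : SChr D → ℂ → ℂ) (k : ℕ) : ℂ :=
  ∑ y ∈ famAt χ k, ∑ ρ ∈ finsetOf (zeroSetS D y),
    (((cstarS c' D y ρ).re * (omegaW D ρ).re : ℝ) : ℂ) * (U y ρ * conj (V y ρ))

/-- **The per-modulus slice of a discrete mean**: `Σ_{ψ ∈ Ψ₁(k)} Σ_ρ Re 𝔠*·‖U‖²·Re ω`.
[cite: Zhang2022LandauSiegel, §2 (2.16), §8 (8.3)] -/
def modMean (U : SChr D → ℂ → ℂ) (k : ℕ) : ℝ :=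
  ∑ y ∈ famAt χ k, ∑ ρ ∈ finsetOf (zeroSetS D y), (cstarS c' D y ρ).re * ‖U y ρ‖ ^ 2 * (omegaW D ρ).re

/-- The diagonal of the polar slice is the mean slice. [cite: Zhang2022LandauSiegel, §2 (2.16)–(2.17)] -/
theorem modPolar_self (U : SChr D → ℂ → ℂ) (k : ℕ) : modPolar c' χ U U k = (modMean c' χ U k : ℂ) := by
  unfold modPolar modMean
  push_cast
  refine Finset.sum_congr rfl fun y _ => Finset.sum_congr rfl fun ρ _ => ?_
  rw [Complex.mul_conj, Complex.normSq_eq_norm_sq]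
  push_cast
  ring

variable (ψc : ℝ → ℝ)

/-- **The Siegel family's discrete polar form**: `Σ_{m ∈ W} w(m)·(slice at m)` — every modulus of the window,
weighted by the Siegel density. [cite: Zhang2022LandauSiegel, §2 (2.17); TaoTeravainen2021, §5] -/
def discPolarS (U V : SChr D → ℂ → ℂ) : ℂ :=
  ∑ m ∈ moduliWindow D, (siegelDensity χ ψc m : ℂ) * modPolar c' χ U V m

/-- **The Siegel family's discrete mean**: `Σ_{m ∈ W} w(m)·Σ_{ψ ∈ Ψ₁(m)} Σ_ρ Re 𝔠*·‖U‖²·Re ω`.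
[cite: Zhang2022LandauSiegel, §2 (2.16); TaoTeravainen2021, §5] -/
def discMeanS (U : SChr D → ℂ → ℂ) : ℝ :=
  ∑ m ∈ moduliWindow D, siegelDensity χ ψc m * modMean c' χ U m

/-- The diagonal of the Siegel polar form is the Siegel mean. [cite: Zhang2022LandauSiegel, §2 (2.16)–(2.17)] -/
theorem discPolarS_self (U : SChr D → ℂ → ℂ) : discPolarS c' χ ψc U U = (discMeanS c' χ ψc U : ℂ) := by
  unfold discPolarS discMeanS
  push_cast
  exact Finset.sum_congr rfl fun m _ => by rw [modPolar_self]

end Slices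

/-! ### Part 5 — Zhang's prime family is the prime fibre: its polar form / mean is the unweighted sum of slices (proved) -/

section PrimeFibre

variable (c' : ℝ) (χ : DirichletCharacter ℂ D)

/-- **Re-indexing by the modulus.** A sum over `Skeleton.idx χ` (pairs `(ψ, ρ)`, `ψ ∈ Ψ₁`) of a function of the
Siegel-family image is the sum over the PRIME moduli `p ∼ P` of the per-modulus sums over `famAt χ p × 𝔷(ψ)`.
[cite: Zhang2022LandauSiegel, §2 (2.16)] -/
theorem sum_idx_eq_sum_primeWindow {M : Type*} [AddCommMonoid M] (f : SChr D → ℂ → M) :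
    ∑ i ∈ idx χ, f (toS i.1) i.2
      = ∑ p ∈ primeWindow D, ∑ y ∈ famAt χ p, ∑ ρ ∈ finsetOf (zeroSetS D y), f y ρ := by
  classical
  rw [idx, Finset.sum_sigma]
  -- push the outer sum through the embedding `toS`
  have hmap : ∑ x ∈ finsetOf (PsiOne χ), ∑ ρ ∈ finsetOf (zeroSet D x), f (toS x) ρ
      = ∑ y ∈ (finsetOf (PsiOne χ)).map ⟨toS, toS_injective⟩, ∑ ρ ∈ finsetOf (zeroSetS D y), f y ρ := by
    rw [Finset.sum_map]
    rfl
  rw [hmap]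
  -- fibre the image over the modulus
  have hmaps : ∀ y ∈ (finsetOf (PsiOne χ)).map ⟨toS, toS_injective⟩, y.m ∈ primeWindow D := by
    intro y hy
    obtain ⟨x, _, rfl⟩ := Finset.mem_map.mp hy
    exact x.mem
  rw [← Finset.sum_fiberwise_of_maps_to hmaps]
  refine Finset.sum_congr rfl fun p hp => Finset.sum_congr ?_ fun _ _ => rfl
  -- the fibre over a prime modulus `p` is `famAt χ p`
  have hprime : p.Prime := (Finset.mem_filter.mp hp).2
  ext y
  rw [Finset.mem_filter, mem_famAt, Finset.mem_map]
  constructor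
  · rintro ⟨⟨x, hx, rfl⟩, hm⟩
    exact ⟨hm, (toS_mem_psiOneS χ x).mpr (mem_of_mem_finsetOf hx)⟩
  · rintro ⟨hm, hy⟩
    have hpm : y.m.Prime := hm ▸ hprime
    refine ⟨⟨y.toChr hpm, ?_, toS_toChr y hpm⟩, hm⟩
    rw [mem_finsetOf (Set.toFinite _), ← toS_mem_psiOneS, toS_toChr]
    exact hy

/-- **Zhang's discrete polar form is the sum of the per-modulus slices over the prime moduli** (tables given on the
Siegel family and restricted along `toS`). [cite: Zhang2022LandauSiegel, §2 (2.17), §8 (8.3)] -/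
theorem discPolar_eq_sum_modPolar (U V : SChr D → ℂ → ℂ) :
    discPolar c' χ (fun x => U (toS x)) (fun x => V (toS x)) = ∑ p ∈ primeWindow D, modPolar c' χ U V p := by
  unfold discPolar modPolar
  rw [← sum_idx_eq_sum_primeWindow χ
    (fun y ρ => (((cstarS c' D y ρ).re * (omegaW D ρ).re : ℝ) : ℂ) * (U y ρ * conj (V y ρ)))]
  rfl

/-- **Zhang's discrete mean is the sum of the per-modulus mean slices over the prime moduli.**
[cite: Zhang2022LandauSiegel, §2 (2.16), §8 (8.3)] -/
theorem discMean_eq_sum_modMean (U : SChr D → ℂ → ℂ) :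
    discMean c' χ (fun x => U (toS x)) = ∑ p ∈ primeWindow D, modMean c' χ U p := by
  unfold discMean modMean
  rw [← sum_idx_eq_sum_primeWindow χ (fun y ρ => (cstarS c' D y ρ).re * ‖U y ρ‖ ^ 2 * (omegaW D ρ).re)]
  rfl

end PrimeFibre

end Literature.NumberTheory.LFunctions.Zhang2022.KnifeEdge

end
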